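import Summits.Ventures.PercRepro.RankLevelSetTelFormKY
import Summits.Ventures.PercRepro.S2TelescopeCount7
import Summits.Ventures.PercRepro.S1IndepSevenCount

/-!
# PercRepro — THE BONFERRONI RECOMBINATION AT LEVEL `7`: `#{r = 7, |B| ≤ d} ≤ nsideTelK7` (p8, gen 21; a feeder for S4)

`count_le_nsideTelK7` — from the telescoping count with the independent `7`-sets at level `7`
(`S2.ncard_eRk_eq_ncard_le_le_tel7`, instantiated at `q = 7` with the caps `min 79 (7 + d − k)`, `min 39 (6 + d − k)`) and the
Bonferroni count of the independent `7`-sets (`S1.ncard_indep_seven_add_le`: `I₇ + s₃·C(n − 3, 4) ≤ C(n, 7) + C(s₃, 2)·(1 + n +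
C(n, 2))`), the rank-`7` sets of size `≤ d` number at most `nsideTelK7 p d k S3 S4 S5` (RankLevelSetTelFormKY): the first
telescoping term `Λ(1) ≤ Π′` is absorbed into the level-`8` pair count, `s₃·C(n − 3, 5) − s₃·C(n − 3, 4) ≤ S3·(C(n − 3, 5) −
C(n − 3, 4))` (`13 ≤ n`), and the remaining terms are monotone in the pair count. Axioms: standard.
-/

set_option exponentiation.threshold 1024

open scoped Matroid

namespace PercRepro

namespace ThmN

open Set

variable {α : Type}

/-- **The Bonferroni recombination at level `7`**: the telescoping count with the independent `7`-sets at level `7` (the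
hypothesis `hU0K`, the instance of `S2.ncard_eRk_eq_ncard_le_le_tel7` at `q = 7`, `f = min 79 (7 + d − k)`, after the
rewrites `|E| = p + d`, `Σ_{k ∈ [3, 8]}`), the circuit counts `s_k ≤ S_k` and the Bonferroni count of the independent
`7`-sets give `#{r = 7, |B| ≤ d} ≤ nsideTelK7 p d k S3 S4 S5`; `13 ≤ n` for `C(n − 3, 4) ≤ C(n − 3, 5)`. -/
theorem count_le_nsideTelK7 (M : Matroid α) [M.Finite] (p d k S3 S4 S5 : ℕ) (hd8 : 8 ≤ d) (hn : M.E.ncard = p + d)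
    (hn13 : 13 ≤ p + d)
    (hs3 : {C | M.IsCircuit C ∧ C.ncard = 3}.ncard ≤ S3) (hs4 : {C | M.IsCircuit C ∧ C.ncard = 4}.ncard ≤ S4)
    (hs5 : {C | M.IsCircuit C ∧ C.ncard = 5}.ncard ≤ S5)
    (hs6 : {C | M.IsCircuit C ∧ C.ncard = 6}.ncard ≤ (d + 5).choose 6)
    (hs7 : {C | M.IsCircuit C ∧ C.ncard = 7}.ncard ≤ (d + 6).choose 7)
    (hs8 : {C | M.IsCircuit C ∧ C.ncard = 8}.ncard ≤ (d + 7).choose 8)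
    (hC1 : ∀ L ⊆ M.E, M.eRk L = 2 → L.ncard ≤ 3)
    (hU0K : ({B : Set α | B ⊆ M.E ∧ M.eRk B = (7 : ℕ) ∧ B.ncard ≤ d}.ncard : ℚ) ≤
      ({B : Set α | B ⊆ M.E ∧ M.eRk B = (7 : ℕ) ∧ B.ncard = 7}.ncard : ℚ) +
        (∑ j ∈ Finset.range (d - 7), S2.lamTel (((p + d).choose 7 : ℕ) : ℚ)
          ((({C | M.IsCircuit C ∧ C.ncard = 3}.ncard : ℕ) : ℚ) * (((p + d - 3).choose 5 : ℕ) : ℚ) +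
            (({C | M.IsCircuit C ∧ C.ncard = 4}.ncard : ℕ) : ℚ) * (((p + d - 4).choose 4 : ℕ) : ℚ) +
            (({C | M.IsCircuit C ∧ C.ncard = 5}.ncard : ℕ) : ℚ) * (((p + d - 5).choose 3 : ℕ) : ℚ) +
            (({C | M.IsCircuit C ∧ C.ncard = 6}.ncard : ℕ) : ℚ) * (((p + d - 6).choose 2 : ℕ) : ℚ) +
            (({C | M.IsCircuit C ∧ C.ncard = 7}.ncard : ℕ) : ℚ) * (((p + d - 7 : ℕ)) : ℚ) +
            (({C | M.IsCircuit C ∧ C.ncard = 8}.ncard : ℕ) : ℚ) * ((1 : ℕ) : ℚ))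
          (min (min 79 (7 + d - k) - 8) (max ((d + min 33 d) / 2 + 1) (min 32 (d - 1) + 2) - 2))
          (fun ν => ν + S2.rminF ν) (j + 1)) +
        (2 : ℚ) ^ (min 79 (7 + d - k))) :
    ({B : Set α | B ⊆ M.E ∧ M.eRk B = 7 ∧ B.ncard ≤ d}.ncard : ℚ) ≤ nsideTelK7 p d k S3 S4 S5 := by
  -- the cast facts on the raw terms
  have hs3q : (({C | M.IsCircuit C ∧ C.ncard = 3}.ncard : ℕ) : ℚ) ≤ ((S3 : ℕ) : ℚ) := by exact_mod_cast hs3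
  have hs4q : (({C | M.IsCircuit C ∧ C.ncard = 4}.ncard : ℕ) : ℚ) ≤ ((S4 : ℕ) : ℚ) := by exact_mod_cast hs4
  have hs5q : (({C | M.IsCircuit C ∧ C.ncard = 5}.ncard : ℕ) : ℚ) ≤ ((S5 : ℕ) : ℚ) := by exact_mod_cast hs5
  have hs6q : (({C | M.IsCircuit C ∧ C.ncard = 6}.ncard : ℕ) : ℚ) ≤ (((d + 5).choose 6 : ℕ) : ℚ) := by
    exact_mod_cast hs6
  have hs7q : (({C | M.IsCircuit C ∧ C.ncard = 7}.ncard : ℕ) : ℚ) ≤ (((d + 6).choose 7 : ℕ) : ℚ) := by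
    exact_mod_cast hs7
  have hs8q : (({C | M.IsCircuit C ∧ C.ncard = 8}.ncard : ℕ) : ℚ) ≤ (((d + 7).choose 8 : ℕ) : ℚ) := by
    exact_mod_cast hs8
  have hab : (p + d - 3).choose 4 ≤ (p + d - 3).choose 5 :=
    Nat.choose_le_succ_of_lt_half_left (by omega)
  have habq : (((p + d - 3).choose 4 : ℕ) : ℚ) ≤ (((p + d - 3).choose 5 : ℕ) : ℚ) := by exact_mod_cast hab
  have hcast1 : (((p + d - 3).choose 5 - (p + d - 3).choose 4 : ℕ) : ℚ) =
      (((p + d - 3).choose 5 : ℕ) : ℚ) - (((p + d - 3).choose 4 : ℕ) : ℚ) := by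
    rw [Nat.cast_sub hab]
  -- the Bonferroni count at level `7`
  have hbon := S1.ncard_indep_seven_add_le M hC1
  rw [hn] at hbon
  have hbonq : (({B : Set α | B ⊆ M.E ∧ M.eRk B = 7 ∧ B.ncard = 7}.ncard : ℕ) : ℚ) +
      (({C | M.IsCircuit C ∧ C.ncard = 3}.ncard : ℕ) : ℚ) * (((p + d - 3).choose 4 : ℕ) : ℚ) ≤
      (((p + d).choose 7 : ℕ) : ℚ) + (((ThmN.triangles M).ncard.choose 2 : ℕ) : ℚ) *
        (((1 + (p + d) + (p + d).choose 2 : ℕ)) : ℚ) := by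
    exact_mod_cast hbon
  have hchoose : ((ThmN.triangles M).ncard).choose 2 ≤ S3.choose 2 := Nat.choose_le_choose 2 hs3
  have hchq : (((ThmN.triangles M).ncard.choose 2 : ℕ) : ℚ) * (((1 + (p + d) + (p + d).choose 2 : ℕ)) : ℚ) ≤
      ((S3.choose 2 : ℕ) : ℚ) * (((1 + (p + d) + (p + d).choose 2 : ℕ)) : ℚ) :=
    mul_le_mul_of_nonneg_right (by exact_mod_cast hchoose) (Nat.cast_nonneg _)
  have hmul2 : (({C | M.IsCircuit C ∧ C.ncard = 3}.ncard : ℕ) : ℚ) *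
        ((((p + d - 3).choose 5 : ℕ) : ℚ) - (((p + d - 3).choose 4 : ℕ) : ℚ)) ≤
      ((S3 : ℕ) : ℚ) * ((((p + d - 3).choose 5 : ℕ) : ℚ) - (((p + d - 3).choose 4 : ℕ) : ℚ)) :=
    mul_le_mul_of_nonneg_right hs3q (sub_nonneg.2 habq)
  have hmul4 : (({C | M.IsCircuit C ∧ C.ncard = 4}.ncard : ℕ) : ℚ) * (((p + d - 4).choose 4 : ℕ) : ℚ) ≤
      ((S4 : ℕ) : ℚ) * (((p + d - 4).choose 4 : ℕ) : ℚ) :=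
    mul_le_mul_of_nonneg_right hs4q (Nat.cast_nonneg _)
  have hmul5 : (({C | M.IsCircuit C ∧ C.ncard = 5}.ncard : ℕ) : ℚ) * (((p + d - 5).choose 3 : ℕ) : ℚ) ≤
      ((S5 : ℕ) : ℚ) * (((p + d - 5).choose 3 : ℕ) : ℚ) :=
    mul_le_mul_of_nonneg_right hs5q (Nat.cast_nonneg _)
  have hmul6 : (({C | M.IsCircuit C ∧ C.ncard = 6}.ncard : ℕ) : ℚ) * (((p + d - 6).choose 2 : ℕ) : ℚ) ≤
      (((d + 5).choose 6 : ℕ) : ℚ) * (((p + d - 6).choose 2 : ℕ) : ℚ) :=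
    mul_le_mul_of_nonneg_right hs6q (Nat.cast_nonneg _)
  have hmul7 : (({C | M.IsCircuit C ∧ C.ncard = 7}.ncard : ℕ) : ℚ) * (((p + d - 7 : ℕ)) : ℚ) ≤
      (((d + 6).choose 7 : ℕ) : ℚ) * (((p + d - 7 : ℕ)) : ℚ) :=
    mul_le_mul_of_nonneg_right hs7q (Nat.cast_nonneg _)
  have hmul5' : (({C | M.IsCircuit C ∧ C.ncard = 3}.ncard : ℕ) : ℚ) * (((p + d - 3).choose 5 : ℕ) : ℚ) ≤
      ((S3 : ℕ) : ℚ) * (((p + d - 3).choose 5 : ℕ) : ℚ) :=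
    mul_le_mul_of_nonneg_right hs3q (Nat.cast_nonneg _)
  -- the shape of `nsideTelK7`
  have hN7 : nsideTelK7 p d k S3 S4 S5 =
      (((p + d).choose 7 : ℕ) : ℚ) +
      (((S3 : ℕ) : ℚ) * ((((p + d - 3).choose 5 : ℕ) : ℚ) - (((p + d - 3).choose 4 : ℕ) : ℚ)) +
        ((S3.choose 2 : ℕ) : ℚ) * (((1 + (p + d) + (p + d).choose 2 : ℕ)) : ℚ) +
        ((S4 : ℕ) : ℚ) * (((p + d - 4).choose 4 : ℕ) : ℚ) + ((S5 : ℕ) : ℚ) * (((p + d - 5).choose 3 : ℕ) : ℚ) +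
        (((d + 5).choose 6 : ℕ) : ℚ) * (((p + d - 6).choose 2 : ℕ) : ℚ) +
        (((d + 6).choose 7 : ℕ) : ℚ) * (((p + d - 7 : ℕ)) : ℚ) + (((d + 7).choose 8 : ℕ) : ℚ)) +
      ∑ j ∈ Finset.range (d - 8), S2.lamTel (((p + d).choose 7 : ℕ) : ℚ)
        (((S3 : ℕ) : ℚ) * (((p + d - 3).choose 5 : ℕ) : ℚ) + ((S4 : ℕ) : ℚ) * (((p + d - 4).choose 4 : ℕ) : ℚ) +
          ((S5 : ℕ) : ℚ) * (((p + d - 5).choose 3 : ℕ) : ℚ) +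
          (((d + 5).choose 6 : ℕ) : ℚ) * (((p + d - 6).choose 2 : ℕ) : ℚ) +
          (((d + 6).choose 7 : ℕ) : ℚ) * (((p + d - 7 : ℕ)) : ℚ) + (((d + 7).choose 8 : ℕ) : ℚ))
        (min (min 79 (7 + d - k) - 8) (max ((d + min 33 d) / 2 + 1) (min 32 (d - 1) + 2) - 2))
        (fun ν => ν + S2.rminF ν) (j + 2) +
      (2 : ℚ) ^ (min 79 (7 + d - k)) := by
    unfold nsideTelK7
    rw [hcast1]
  rw [hN7]
  -- abbreviations
  set cq : ℚ := (((p + d).choose 7 : ℕ) : ℚ) with hcq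
  set F := min (min 79 (7 + d - k) - 8) (max ((d + min 33 d) / 2 + 1) (min 32 (d - 1) + 2) - 2) with hF
  set ρ := (fun ν => ν + S2.rminF ν) with hρdef
  set Pq : ℚ := (({C | M.IsCircuit C ∧ C.ncard = 3}.ncard : ℕ) : ℚ) * (((p + d - 3).choose 5 : ℕ) : ℚ) +
      (({C | M.IsCircuit C ∧ C.ncard = 4}.ncard : ℕ) : ℚ) * (((p + d - 4).choose 4 : ℕ) : ℚ) +
      (({C | M.IsCircuit C ∧ C.ncard = 5}.ncard : ℕ) : ℚ) * (((p + d - 5).choose 3 : ℕ) : ℚ) +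
      (({C | M.IsCircuit C ∧ C.ncard = 6}.ncard : ℕ) : ℚ) * (((p + d - 6).choose 2 : ℕ) : ℚ) +
      (({C | M.IsCircuit C ∧ C.ncard = 7}.ncard : ℕ) : ℚ) * (((p + d - 7 : ℕ)) : ℚ) +
      (({C | M.IsCircuit C ∧ C.ncard = 8}.ncard : ℕ) : ℚ) * ((1 : ℕ) : ℚ) with hPq
  set PS : ℚ := ((S3 : ℕ) : ℚ) * (((p + d - 3).choose 5 : ℕ) : ℚ) + ((S4 : ℕ) : ℚ) * (((p + d - 4).choose 4 : ℕ) : ℚ) +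
      ((S5 : ℕ) : ℚ) * (((p + d - 5).choose 3 : ℕ) : ℚ) +
      (((d + 5).choose 6 : ℕ) : ℚ) * (((p + d - 6).choose 2 : ℕ) : ℚ) +
      (((d + 6).choose 7 : ℕ) : ℚ) * (((p + d - 7 : ℕ)) : ℚ) + (((d + 7).choose 8 : ℕ) : ℚ) with hPS
  have hPqS : Pq ≤ PS := by
    rw [hPq, hPS, Nat.cast_one, mul_one]
    linarith only [hmul5', hmul4, hmul5, hmul6, hmul7, hs8q]
  have hPqexp : Pq = (({C | M.IsCircuit C ∧ C.ncard = 3}.ncard : ℕ) : ℚ) * (((p + d - 3).choose 5 : ℕ) : ℚ) +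
      (({C | M.IsCircuit C ∧ C.ncard = 4}.ncard : ℕ) : ℚ) * (((p + d - 4).choose 4 : ℕ) : ℚ) +
      (({C | M.IsCircuit C ∧ C.ncard = 5}.ncard : ℕ) : ℚ) * (((p + d - 5).choose 3 : ℕ) : ℚ) +
      (({C | M.IsCircuit C ∧ C.ncard = 6}.ncard : ℕ) : ℚ) * (((p + d - 6).choose 2 : ℕ) : ℚ) +
      (({C | M.IsCircuit C ∧ C.ncard = 7}.ncard : ℕ) : ℚ) * (((p + d - 7 : ℕ)) : ℚ) +
      (({C | M.IsCircuit C ∧ C.ncard = 8}.ncard : ℕ) : ℚ) := by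
    rw [hPq, Nat.cast_one, mul_one]
  have hsplit : ∑ j ∈ Finset.range (d - 7), S2.lamTel cq Pq F ρ (j + 1) =
      S2.lamTel cq Pq F ρ 1 + ∑ j ∈ Finset.range (d - 8), S2.lamTel cq Pq F ρ (j + 2) := by
    rw [show d - 7 = (d - 8) + 1 by omega, Finset.sum_range_succ', add_comm]
  have hlam1 : S2.lamTel cq Pq F ρ 1 ≤ Pq := by
    rw [S2.lamTel_succ]
    refine (min_le_left _ _).trans ?_
    simp only [Nat.choose_zero_right]
    norm_num [Nat.choose]
  have hmono : ∑ j ∈ Finset.range (d - 8), S2.lamTel cq Pq F ρ (j + 2) ≤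
      ∑ j ∈ Finset.range (d - 8), S2.lamTel cq PS F ρ (j + 2) :=
    Finset.sum_le_sum fun j _ => S2.lamTel_mono _ _ _ _ _ hPqS _
  push_cast at hU0K
  rw [hsplit] at hU0K
  linarith only [hU0K, hlam1, hmono, hbonq, hchq, hmul2, hmul4, hmul5, hmul6, hmul7, hs8q, hPqexp]

end ThmN

end PercRepro
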